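import Literature.MathematicalPhysics.QuantumFieldTheory.TwistedPartitionFunction
import HarnessLib

/-!
# 't Hooft's twist-eating link configuration (audit helper for stub EQUI of crux
`NonSimplyConnectedLatticeGap`, line `twist-equipartition-blindness`)

For two group elements `h, k` and a coordinate plane `q = (μ, ν)`, the link configuration
`T(x, μ) = h` if `x_μ = 0`, `T(x, ν) = k` if `x_ν = 0`, `T = 1` on every other link, has plaquette
holonomy equal to the commutator `h k h⁻¹ k⁻¹` on exactly the plaquettes of plane `q` based in the
stack `{x_μ = 0, x_ν = 0}` and `1` on every other plaquette, i.e. its plaquette field IS the stack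
insertion `stackInsertion (h k h⁻¹ k⁻¹) q 0 0` ('t Hooft's "twist eater"; Greensite 2011 §4.4).
Consequence used in the audit: whenever a flux pattern is a commutator pattern, its sector contains
an exactly centre-valued ("zero blind action") configuration, hence — for any interface labelling —
an open set of positive Wilson mass; patterns that are NOT commutator patterns (e.g. the
Pfaffian-odd patterns of `SU(2) → SO(3)`) have no such representative.
-/

set_option autoImplicit false

namespace Summit.QuantumFields.YangMills.Theorems.NonSimplyConnectedLatticeGap

open Literature.MathematicalPhysics.QuantumFieldTheory

/-- **Twist eater.** The configuration with `h` on the `μ`-links of the hyperplane `x_μ = 0`, `k` on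
the `ν`-links of the hyperplane `x_ν = 0` (`q = (μ, ν)`, `μ < ν`) and `1` elsewhere has plaquette
holonomy `stackInsertion (h * k * h⁻¹ * k⁻¹) q 0 0`: the commutator on the plaquettes of plane `q`
based at `x_μ = x_ν = 0`, and `1` on all other plaquettes. [folklore] -/
theorem plaquetteHolonomy_twistEater : ∀ {d L : ℕ} {G : Type*} [Group G] (h k : G)
    (q : {p : Fin d × Fin d // p.1 < p.2}) (x : Literature.MathematicalPhysics.QuantumFieldTheory.Site d L)
    (i j : Fin d) (hij : i < j), Literature.MathematicalPhysics.QuantumFieldTheory.plaquetteHolonomy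
    (fun e : Literature.MathematicalPhysics.QuantumFieldTheory.Edge d L => if e.2 = q.1.1 ∧ e.1 q.1.1 = 0
    then h else if e.2 = q.1.2 ∧ e.1 q.1.2 = 0 then k else 1) x i j =
    Literature.MathematicalPhysics.QuantumFieldTheory.stackInsertion (h * k * h⁻¹ * k⁻¹) q 0 0
    (x, ⟨(i, j), hij⟩) := by
  intro d L G _ h k q x i j hij
  obtain ⟨⟨μ, ν⟩, hμν⟩ := q
  have hμν' : μ ≠ ν := ne_of_lt hμν
  have hij' : i ≠ j := ne_of_lt hij
  -- evaluation of the configuration on an arbitrary link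
  have hU : ∀ (y : Site d L) (l : Fin d),
      (if l = μ ∧ y μ = 0 then h else if l = ν ∧ y ν = 0 then k else (1 : G)) =
        if l = μ then (if y μ = 0 then h else 1) else
          if l = ν then (if y ν = 0 then k else 1) else 1 := by
    intro y l
    by_cases hl : l = μ
    · subst hl
      by_cases hy : y l = 0 <;> simp [hy, hμν']
    · by_cases hl' : l = ν
      · subst hl'
        by_cases hy : y l = 0 <;> simp [hy, hl]
      · simp [hl, hl']
  simp only [plaquetteHolonomy, stackInsertion, Subtype.mk.injEq, Prod.mk.injEq, hU]
  by_cases hiμ : i = μ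
  · subst hiμ
    have hjμ : j ≠ i := hij'.symm
    by_cases hjν : j = ν
    · subst hjν
      simp only [if_true, hjμ, if_false, WilsonRP.shift_apply_of_ne _ hjμ,
        WilsonRP.shift_apply_of_ne _ hij', true_and]
      by_cases hxμ : x i = 0 <;> by_cases hxν : x j = 0 <;> simp [hxμ, hxν]
    · simp only [if_true, hjμ, hjν, if_false, WilsonRP.shift_apply_of_ne _ hij', mul_one,
        inv_one, false_and, and_false]
      by_cases hxμ : x i = 0 <;> simp [hxμ]
  · by_cases hiν : i = ν
    · subst hiν
      have hjμ : j ≠ μ := fun hc => (lt_asymm hμν) (hc ▸ hij)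
      have hjν : j ≠ i := hij'.symm
      simp only [hiμ, if_false, if_true, hjμ, hjν, WilsonRP.shift_apply_of_ne _ hij', mul_one,
        inv_one, false_and]
      by_cases hxν : x i = 0 <;> simp [hxν]
    · by_cases hjμ : j = μ
      · subst hjμ
        simp only [hiμ, hiν, if_false, if_true, WilsonRP.shift_apply_of_ne _ hij'.symm, one_mul,
          inv_one, mul_one, false_and]
        by_cases hxμ : x j = 0 <;> simp [hxμ]
      · by_cases hjν : j = ν
        · subst hjν
          simp only [hiμ, hiν, hjμ, if_false, if_true, WilsonRP.shift_apply_of_ne _ hij'.symm,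
            one_mul, inv_one, false_and]
          by_cases hxν : x j = 0 <;> simp [hxν]
        · simp [hiμ, hiν, hjμ, hjν]

end Summit.QuantumFields.YangMills.Theorems.NonSimplyConnectedLatticeGap
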